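import Mathlib
import HarnessLib
import Literature.MathematicalPhysics.QuantumLattice.DWaveSourceFreePressure
import Summits.HubbardSuperconductivity.HubbardSuperconductivity.Theorems.ThermalWedgeTwSeededEnsembleEquivalenceRRiemannGrid

/-!
# Route `ThermalWedge`, crux `TwSeededEnsembleEquivalenceR` (stmt-HubbardSuperconductivity-15581):
# the thermodynamic limit of the FREE d-wave-sourced torus pressure is the BdG Brillouin-zone integral

Support file (`--supports stmt-HubbardSuperconductivity-15581`; no definition; the route file is NOT imported).
For `U = 0` the sourced torus pressure is explicit (tree `partitionFn_dWaveSourceTorus_zero_re`, `L ≥ 3`):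

  `log Re Z_β(dWaveSourceTorus L 0 μ s) = 2L² log 2 + Σ_k [−βξ_k + log((1 + cosh βE_k)/2)]`,
  `ξ_k = ε_L(k) − μ = −2(cos k₁ + cos k₂) − μ`, `E_k² = ξ_k² + 8s²(cos k₁ − cos k₂)²`, `k = 2πκ/L`

(`twR_log_partitionFn_free_eq`), a grid average of a continuous function of the two momentum angles
(`twR_free_sum_eq_gridSum`), hence (`twR_abs_gridAverage_sub_integral_le`) its thermodynamic limit is the
Brillouin-zone integral:

* `twR_freeSourcedPressure_limit` — for all real `β > 0`, `μ`, `s`: for every `κ > 0`, eventually in `L`,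
  `|log Re Z_β(dWaveSourceTorus L 0 μ s)/(βL²) − [2 log 2/β + (4π²β)⁻¹ ∫₀^{2π}∫₀^{2π} (−βξ + log((1+cosh βE)/2)) dy dx]| ≤ κ`.

So every pointwise thermodynamic limit `q₀(μ, s)` of the free sourced pressure (as consumed by the line's
`stub_freeColdEdgeIncrements`) IS this integral. Bardeen–Cooper–Schrieffer 1957 §III; de Gennes 1966 Ch. 4
(BdG free energy `−β⁻¹ Σ_k [βξ_k − 2 log(2cosh(βE_k/2))]`). [folklore]
-/

set_option linter.dupNamespace false

noncomputable section

namespace Summit.HubbardSuperconductivity.HubbardSuperconductivity.Theorems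

open Literature.MathematicalPhysics.QuantumLattice Literature.Probability.LatticeModels Matrix Finset Filter
  MeasureTheory intervalIntegral
open scoped Topology Real

/-! ### The finite-volume free pressure as a grid sum -/

section Free

variable {L : ℕ} [NeZero L]

/-- **The free sourced log-partition function** (`L ≥ 3`):
`log Re Z = 2L² log 2 + Σ_k [−βξ_k + log((1 + cosh βE_k)/2)]`. [folklore] -/
theorem twR_log_partitionFn_free_eq (hL : 3 ≤ L) (β μ s : ℝ) :
    Real.log (partitionFn β (dWaveSourceTorus L 0 μ s)).re =
      (2 * L ^ 2 : ℕ) * Real.log 2 +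
        ∑ k : TorusSite 2 L, (-(β * (torusBand L k - μ)) +
          Real.log ((1 + Real.cosh (β * Real.sqrt ((torusBand L k - μ) ^ 2 + (2 * Real.sqrt 2 * s * dWaveGap k) ^ 2))) / 2)) := by
  rw [partitionFn_dWaveSourceTorus_zero_re hL, card_orb_fermionTorus_two]
  have hpow : (0 : ℝ) < (2 : ℝ) ^ (2 * L ^ 2) := by positivity
  have hfac : ∀ k : TorusSite 2 L, Real.exp (-(β * (torusBand L k - μ))) *
      ((1 + Real.cosh (β * Real.sqrt ((torusBand L k - μ) ^ 2 + (2 * Real.sqrt 2 * s * dWaveGap k) ^ 2))) / 2) ≠ 0 :=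
    fun k => (bdgModeFactor_pos β _ _).ne'
  rw [Real.log_mul hpow.ne' (Finset.prod_ne_zero_iff.2 fun k _ => hfac k), Real.log_pow,
    Real.log_prod (s := Finset.univ) (hf := fun k _ => hfac k)]
  congr 1
  refine Finset.sum_congr rfl fun k _ => ?_
  have hcosh : 0 < (1 + Real.cosh (β * Real.sqrt ((torusBand L k - μ) ^ 2 + (2 * Real.sqrt 2 * s * dWaveGap k) ^ 2))) / 2 := by
    have := Real.one_le_cosh (β * Real.sqrt ((torusBand L k - μ) ^ 2 + (2 * Real.sqrt 2 * s * dWaveGap k) ^ 2))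
    positivity
  rw [Real.log_mul (Real.exp_pos _).ne' hcosh.ne', Real.log_exp]

omit [NeZero L] in
/-- The band and the d-wave form factor in the momentum angles `2πκᵢ/L`. [folklore] -/
theorem twR_torusBand_dWaveGap_eq (k : TorusSite 2 L) :
    torusBand L k = -2 * (Real.cos (2 * π * ((k 0).val : ℝ) / L) + Real.cos (2 * π * ((k 1).val : ℝ) / L)) ∧
      dWaveGap k = Real.cos (2 * π * ((k 0).val : ℝ) / L) - Real.cos (2 * π * ((k 1).val : ℝ) / L) := by
  refine ⟨?_, rfl⟩
  simp only [torusBand, latticeMomentum, Fin.sum_univ_two]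

/-- **Momentum sums are grid sums**: `Σ_{k ∈ (ℤ/L)²} G(κ₀, κ₁) = Σ_{i<L} Σ_{j<L} G(i, j)` (canonical representatives). [folklore] -/
theorem twR_sum_torusSite_eq_sum_range {M : Type*} [AddCommMonoid M] (G : ℕ → ℕ → M) :
    ∑ k : TorusSite 2 L, G (k 0).val (k 1).val = ∑ i ∈ range L, ∑ j ∈ range L, G i j := by
  obtain ⟨n, rfl⟩ : ∃ n, L = n + 1 := ⟨L - 1, (Nat.succ_pred_eq_of_pos (Nat.pos_of_ne_zero (NeZero.ne L))).symm⟩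
  rw [← (piFinTwoEquiv fun _ : Fin 2 => ZMod (n + 1)).symm.sum_comp, Fintype.sum_prod_type]
  have hcomp : ∀ a b : ZMod (n + 1),
      G (((piFinTwoEquiv fun _ : Fin 2 => ZMod (n + 1)).symm (a, b)) 0).val
        (((piFinTwoEquiv fun _ : Fin 2 => ZMod (n + 1)).symm (a, b)) 1).val = G a.val b.val := fun a b => by
    simp [piFinTwoEquiv]
  simp_rw [hcomp]
  -- `ZMod (n+1) = Fin (n+1)` and `ZMod.val = Fin.val` definitionally
  show ∑ a : Fin (n + 1), ∑ b : Fin (n + 1), G (a : ℕ) (b : ℕ) = _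
  calc ∑ a : Fin (n + 1), ∑ b : Fin (n + 1), G (a : ℕ) (b : ℕ)
      = ∑ a : Fin (n + 1), ∑ j ∈ range (n + 1), G (a : ℕ) j :=
        Finset.sum_congr rfl fun a _ => Fin.sum_univ_eq_sum_range (G a) (n + 1)
    _ = ∑ i ∈ range (n + 1), ∑ j ∈ range (n + 1), G i j :=
        Fin.sum_univ_eq_sum_range (fun i => ∑ j ∈ range (n + 1), G i j) (n + 1)

/-- **The free sourced pressure is a grid average**: for `L ≥ 3`,
`log Re Z_β = 2L² log 2 + Σ_{i,j<L} F(2πi/L, 2πj/L)` with the BdG integrand `F`. [folklore] -/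
theorem twR_log_partitionFn_free_eq_gridSum (hL : 3 ≤ L) (β μ s : ℝ) :
    Real.log (partitionFn β (dWaveSourceTorus L 0 μ s)).re =
      (2 * L ^ 2 : ℕ) * Real.log 2 +
        ∑ i ∈ range L, ∑ j ∈ range L,
          (-(β * (-2 * (Real.cos (2 * π * i / L) + Real.cos (2 * π * j / L)) - μ)) +
            Real.log ((1 + Real.cosh (β * Real.sqrt ((-2 * (Real.cos (2 * π * i / L) + Real.cos (2 * π * j / L)) - μ) ^ 2 +
              (2 * Real.sqrt 2 * s * (Real.cos (2 * π * i / L) - Real.cos (2 * π * j / L))) ^ 2))) / 2)) := by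
  rw [twR_log_partitionFn_free_eq hL]
  congr 1
  rw [← twR_sum_torusSite_eq_sum_range (L := L) (fun i j : ℕ =>
    (-(β * (-2 * (Real.cos (2 * π * i / L) + Real.cos (2 * π * j / L)) - μ)) +
      Real.log ((1 + Real.cosh (β * Real.sqrt ((-2 * (Real.cos (2 * π * i / L) + Real.cos (2 * π * j / L)) - μ) ^ 2 +
        (2 * Real.sqrt 2 * s * (Real.cos (2 * π * i / L) - Real.cos (2 * π * j / L))) ^ 2))) / 2)))]
  refine Finset.sum_congr rfl fun k _ => ?_
  obtain ⟨hb, hg⟩ := twR_torusBand_dWaveGap_eq (L := L) k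
  rw [hb, hg]

end Free

/-! ### The BdG integrand is continuous -/

/-- The BdG integrand `(x,y) ↦ −βξ + log((1 + cosh βE)/2)` is continuous on `ℝ²`. [folklore] -/
theorem twR_continuous_bdgIntegrand (β μ s : ℝ) :
    Continuous (Function.uncurry fun x y : ℝ =>
      (-(β * (-2 * (Real.cos x + Real.cos y) - μ)) +
        Real.log ((1 + Real.cosh (β * Real.sqrt ((-2 * (Real.cos x + Real.cos y) - μ) ^ 2 +
          (2 * Real.sqrt 2 * s * (Real.cos x - Real.cos y)) ^ 2))) / 2))) := by
  have hc1 : Continuous fun p : ℝ × ℝ => Real.cos p.1 := Real.continuous_cos.comp continuous_fst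
  have hc2 : Continuous fun p : ℝ × ℝ => Real.cos p.2 := Real.continuous_cos.comp continuous_snd
  have hξ : Continuous fun p : ℝ × ℝ => -2 * (Real.cos p.1 + Real.cos p.2) - μ := by fun_prop
  have hE : Continuous fun p : ℝ × ℝ => β * Real.sqrt ((-2 * (Real.cos p.1 + Real.cos p.2) - μ) ^ 2 +
      (2 * Real.sqrt 2 * s * (Real.cos p.1 - Real.cos p.2)) ^ 2) := by fun_prop
  have harg : Continuous fun p : ℝ × ℝ => (1 + Real.cosh (β * Real.sqrt ((-2 * (Real.cos p.1 + Real.cos p.2) - μ) ^ 2 +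
      (2 * Real.sqrt 2 * s * (Real.cos p.1 - Real.cos p.2)) ^ 2))) / 2 :=
    (continuous_const.add (Real.continuous_cosh.comp hE)).div_const _
  have hpos : ∀ p : ℝ × ℝ, (1 + Real.cosh (β * Real.sqrt ((-2 * (Real.cos p.1 + Real.cos p.2) - μ) ^ 2 +
      (2 * Real.sqrt 2 * s * (Real.cos p.1 - Real.cos p.2)) ^ 2))) / 2 ≠ 0 := fun p => by
    have := Real.one_le_cosh (β * Real.sqrt ((-2 * (Real.cos p.1 + Real.cos p.2) - μ) ^ 2 +
      (2 * Real.sqrt 2 * s * (Real.cos p.1 - Real.cos p.2)) ^ 2))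
    positivity
  exact (hξ.const_mul β).neg.add (harg.log hpos)

/-! ### The thermodynamic limit of the free sourced pressure -/

/-- **The free d-wave-sourced torus pressure converges to the BdG Brillouin-zone integral** (registered sub-goal
`twR_freeSourcedPressure_limit` of stmt-HubbardSuperconductivity-15581): for all real `β > 0`, `μ`, `s`, for every
`κ > 0` there is `L₀` such that for all `L ≥ L₀`,
`|log Re Z_β(dWaveSourceTorus L 0 μ s)/(βL²) − (2 log 2/β + (4π²β)⁻¹ ∫₀^{2π}∫₀^{2π} [−βξ(x,y) + log((1 + cosh βE(x,y))/2)] dy dx)| ≤ κ`,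
`ξ = −2(cos x + cos y) − μ`, `E² = ξ² + 8s²(cos x − cos y)²`. [folklore] -/
theorem twR_freeSourcedPressure_limit : ∀ (β μ s : ℝ), 0 < β → ∀ κ : ℝ, 0 < κ → ∃ L₀ : ℕ, ∀ (L : ℕ) [NeZero L], L₀ ≤ L → |Real.log (Matrix.partitionFn β (dWaveSourceTorus L 0 μ s)).re / (β * (L : ℝ) ^ 2) - (2 * Real.log 2 / β + (1 / (4 * π ^ 2 * β)) * ∫ x in (0 : ℝ)..2 * π, ∫ y in (0 : ℝ)..2 * π, (-(β * (-2 * (Real.cos x + Real.cos y) - μ)) + Real.log ((1 + Real.cosh (β * Real.sqrt ((-2 * (Real.cos x + Real.cos y) - μ) ^ 2 + (2 * Real.sqrt 2 * s * (Real.cos x - Real.cos y)) ^ 2))) / 2)))| ≤ κ := by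
  intro β μ s hβ κ hκ
  obtain ⟨L₁, hL₁⟩ := twR_abs_gridAverage_sub_integral_le (twR_continuous_bdgIntegrand β μ s) (ε := β * κ) (by positivity)
  refine ⟨max 3 L₁, fun L _ hL => ?_⟩
  have hL3 : 3 ≤ L := le_of_max_le_left hL
  have hLL : L₁ ≤ L := le_of_max_le_right hL
  have hLpos : (0 : ℝ) < L := by exact_mod_cast (show 0 < L by omega)
  have hL2 : (0 : ℝ) < (L : ℝ) ^ 2 := by positivity
  have hgrid := hL₁ L hLL
  set T := ∑ i ∈ range L, ∑ j ∈ range L,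
    (-(β * (-2 * (Real.cos (2 * π * i / L) + Real.cos (2 * π * j / L)) - μ)) +
      Real.log ((1 + Real.cosh (β * Real.sqrt ((-2 * (Real.cos (2 * π * i / L) + Real.cos (2 * π * j / L)) - μ) ^ 2 +
        (2 * Real.sqrt 2 * s * (Real.cos (2 * π * i / L) - Real.cos (2 * π * j / L))) ^ 2))) / 2)) with hT
  set I := ∫ x in (0 : ℝ)..2 * π, ∫ y in (0 : ℝ)..2 * π, (-(β * (-2 * (Real.cos x + Real.cos y) - μ)) +
    Real.log ((1 + Real.cosh (β * Real.sqrt ((-2 * (Real.cos x + Real.cos y) - μ) ^ 2 +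
      (2 * Real.sqrt 2 * s * (Real.cos x - Real.cos y)) ^ 2))) / 2)) with hI
  rw [twR_log_partitionFn_free_eq_gridSum hL3 β μ s]
  -- `(2L² log 2 + T)/(βL²) − (2 log 2/β + I/(4π²β)) = ((1/L²) T − I/(4π²))/β`
  have e : ((2 * L ^ 2 : ℕ) * Real.log 2 + T) / (β * (L : ℝ) ^ 2) - (2 * Real.log 2 / β + 1 / (4 * π ^ 2 * β) * I) =
      ((1 / (L : ℝ) ^ 2) * T - (1 / (4 * π ^ 2)) * I) / β := by
    push_cast
    field_simp
    ring
  rw [e, abs_div, abs_of_pos hβ, div_le_iff₀ hβ]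
  calc |1 / (L : ℝ) ^ 2 * T - 1 / (4 * π ^ 2) * I| ≤ β * κ := hgrid
    _ = κ * β := mul_comm _ _

end Summit.HubbardSuperconductivity.HubbardSuperconductivity.Theorems

end
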